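import Mathlib
import HarnessLib
import Literature.Analysis.FluidPDE.SuitableWeak
import Literature.Analysis.FluidPDE.SelfSimilar
import Literature.Analysis.FluidPDE.LocalTypeI
import Literature.Analysis.FluidPDE.NSBoundedMildOseen
import Summits.NavierStokesRegularity.NavierStokesRegularity.Theses.RellichScar

/-!
# drefute (gen 2) — line `decaying-ancient-bridge`, crux stmt-NavierStokesRegularity-11719 `ApexLocalisation`

Refuter certificates (second, independent deep-refute pass) for the lead's skeleton
`Cruxes/ApexLocalisation/Lines/decaying-ancient-bridge.lean` (sha `adc980f7…`, namespace
`…Theorems.RellichScarApexLocalisation`, stubs `stub_slabCompactness`, `stub_rateToAncient`,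
`stub_radiationBound`, `stub_hullSelection`, `stub_hullClosed`, `stub_apexOfDecaying`).

Verdict of this pass: 0 stub-false, 0 stub-misstated, 6 survived (same as gen 1 / cdisprove g3), with
three corrections / sharpenings recorded in `SUMMARY-g2.md`; this file certifies the two that are
statements of elementary real analysis:

* §1 `hullScale_mul_norm_le`, `hullScale_le_div`, `tk_le_of_large_scale` — about the "enlarged hull"
  proposed by gen 1 (allow zoom-OUTS `λ_k > 1` subject to a uniform bound `B'` on the hull images):
  a hull image `λ M(t_k + λ² s, x_k + λ y)` bounded by `B'` on the slab has `λ ‖M t₀ x₀‖ ≤ B'` for every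
  point `(t₀, x₀)` of `M` with `t₀ < t_k`; hence zoom-outs beyond `B'/‖M t₀ x₀‖` are only admissible with
  `t_k ≤ t₀`, i.e. the enlargement adds exactly the blow-DOWN sequences receding into the past
  (`t_k → -∞` at least as fast as the activity of `M` allows), NOT a renormalisation of weak far blobs at
  bounded times (those violate `B'`). The enlargement is harmless but buys less than gen 1's Addendum B says.
* §2 `bounds_of_shiftedDecay` — converse of the skeleton's glue `shiftedDecay_of_bounds`: the shifted
  space–time decay `‖N t x‖ ≤ C'/(1 + ‖x‖ + √(-t))` consumed by `stub_apexOfDecaying` gives back the three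
  bounds `‖N‖ ≤ C'`, `HasTypeITimeDecay C' N`, `‖x‖ ‖N t x‖ ≤ C'`; so the interface between
  `stub_hullSelection`/`stub_hullClosed` and `stub_apexOfDecaying` has no slack (equivalent up to constants):
  the bet cannot be weakened through that interface.
-/

set_option linter.dupNamespace false

noncomputable section

open MeasureTheory Set Function Metric Filter Topology TopologicalSpace
open scoped ENNReal NNReal
open Literature.Analysis Literature.Analysis.FluidPDE

namespace Summit.NavierStokesRegularity.NavierStokesRegularity.Cruxes.ApexLocalisation.DrefuteG2

local notation "E³" => EuclideanSpace ℝ (Fin 3)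

/-! ## §1 Enlarged hull: a uniform image bound caps the zoom-out factor by the activity of `M` -/

/-- If the hull image `y ↦ lk • M (tk + lk² s) (xk + lk • y)` is bounded by `B'` at all negative image
times, then `lk * ‖M t₀ x₀‖ ≤ B'` for every point `(t₀, x₀)` with `t₀ < tk` (it is sampled at image time
`s = (t₀ - tk)/lk² < 0`, image position `y = lk⁻¹ • (x₀ - xk)`). [folklore] -/
theorem hullScale_mul_norm_le {M : ℝ → E³ → E³} {B' : ℝ} {xk : E³} {tk lk t₀ : ℝ} {x₀ : E³}
    (hlk : 0 < lk) (ht₀ : t₀ < tk)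
    (hB' : ∀ s < 0, ∀ y : E³, ‖lk • M (tk + lk ^ 2 * s) (xk + lk • y)‖ ≤ B') :
    lk * ‖M t₀ x₀‖ ≤ B' := by
  have hlk2 : (0 : ℝ) < lk ^ 2 := by positivity
  have hs : (t₀ - tk) / lk ^ 2 < 0 := div_neg_of_neg_of_pos (by linarith) hlk2
  have h := hB' ((t₀ - tk) / lk ^ 2) hs (lk⁻¹ • (x₀ - xk))
  have h1 : tk + lk ^ 2 * ((t₀ - tk) / lk ^ 2) = t₀ := by
    field_simp
    ring
  have h2 : xk + lk • (lk⁻¹ • (x₀ - xk)) = x₀ := by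
    rw [smul_smul, mul_inv_cancel₀ hlk.ne', one_smul]
    abel
  rw [h1, h2, norm_smul, Real.norm_of_nonneg hlk.le] at h
  exact h

/-- Hence the zoom-out factor of an admissible image is at most `B'/‖M t₀ x₀‖` at any non-zero point
`(t₀, x₀)` of `M` lying strictly before the time shift `tk`. [folklore] -/
theorem hullScale_le_div {M : ℝ → E³ → E³} {B' : ℝ} {xk : E³} {tk lk t₀ : ℝ} {x₀ : E³}
    (hlk : 0 < lk) (ht₀ : t₀ < tk) (hx₀ : M t₀ x₀ ≠ 0)
    (hB' : ∀ s < 0, ∀ y : E³, ‖lk • M (tk + lk ^ 2 * s) (xk + lk • y)‖ ≤ B') :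
    lk ≤ B' / ‖M t₀ x₀‖ := by
  have hm : 0 < ‖M t₀ x₀‖ := norm_pos_iff.2 hx₀
  rw [le_div_iff₀ hm]
  exact hullScale_mul_norm_le hlk ht₀ hB'

/-- Contrapositive, the form relevant to gen 1's enlarged hull (sequences `lk k → ∞` with images bounded
by `B'`): once `lk k > B'/‖M t₀ x₀‖`, the time shift satisfies `tk k ≤ t₀`. So along a sequence of
zoom-outs with unbounded factor the shifts recede below every activity time of `M` — the added hull
elements are blow-downs into the past, nothing else. [folklore] -/
theorem tk_le_of_large_scale {M : ℝ → E³ → E³} {B' : ℝ} {xk : E³} {tk lk t₀ : ℝ} {x₀ : E³}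
    (hlk : 0 < lk) (hx₀ : M t₀ x₀ ≠ 0) (hbig : B' / ‖M t₀ x₀‖ < lk)
    (hB' : ∀ s < 0, ∀ y : E³, ‖lk • M (tk + lk ^ 2 * s) (xk + lk • y)‖ ≤ B') :
    tk ≤ t₀ := by
  by_contra h
  exact (not_le.2 hbig) (hullScale_le_div hlk (not_le.1 h) hx₀ hB')

/-- Sequence form: if the factors `lk k` tend to `+∞` while all images stay bounded by `B'`, then for
every non-zero point `(t₀, x₀)` of `M`, eventually `tk k ≤ t₀`. [folklore] -/
theorem eventually_tk_le {M : ℝ → E³ → E³} {B' : ℝ} {xk : ℕ → E³} {tk lk : ℕ → ℝ} {t₀ : ℝ} {x₀ : E³}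
    (hlk : ∀ k, 0 < lk k) (hx₀ : M t₀ x₀ ≠ 0)
    (hB' : ∀ k, ∀ s < 0, ∀ y : E³, ‖lk k • M (tk k + lk k ^ 2 * s) (xk k + lk k • y)‖ ≤ B')
    (hlim : Tendsto lk atTop atTop) :
    ∀ᶠ k in atTop, tk k ≤ t₀ := by
  filter_upwards [hlim.eventually_gt_atTop (B' / ‖M t₀ x₀‖)] with k hk
  exact tk_le_of_large_scale (hlk k) hx₀ hk (hB' k)

/-! ## §2 The interface between the bet and the ⇐ transfer has no slack -/

/-- Converse of the skeleton's `shiftedDecay_of_bounds`: the shifted space–time decay gives back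
boundedness, the Type-I rate with the same constant, and the KNSS spatial bound `‖x‖ ‖N‖ ≤ C'`.
(Forward: the three bounds with constants `B, C, K` give the shifted decay with `B + C + K`.) [folklore] -/
theorem bounds_of_shiftedDecay {N : ℝ → E³ → E³} {C' : ℝ}
    (h : ∀ t : ℝ, t < 0 → ∀ x : E³, ‖N t x‖ ≤ C' / (1 + ‖x‖ + Real.sqrt (-t))) :
    (∀ t < 0, ∀ x : E³, ‖N t x‖ ≤ C') ∧ HasTypeITimeDecay C' N ∧
      (∀ s < 0, ∀ y : E³, ‖y‖ * ‖N s y‖ ≤ C') := by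
  -- `C'` is non-negative as soon as the slab is non-empty (it is): test at `t = -1`, `x = 0`.
  have hC' : 0 ≤ C' := by
    have h0 := h (-1) (by norm_num) 0
    have hden : (0 : ℝ) < 1 + ‖(0 : E³)‖ + Real.sqrt (-(-1 : ℝ)) := by positivity
    have : 0 ≤ C' / (1 + ‖(0 : E³)‖ + Real.sqrt (-(-1 : ℝ))) := (norm_nonneg _).trans h0
    exact (div_nonneg_iff.1 this).elim (fun h' => h'.1) fun h' => absurd hden (not_lt.2 h'.2)
  refine ⟨fun t ht x => ?_, fun t ht x => ?_, fun s hs y => ?_⟩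
  · have hden : (1 : ℝ) ≤ 1 + ‖x‖ + Real.sqrt (-t) := by
      have := norm_nonneg x; have := Real.sqrt_nonneg (-t); linarith
    calc ‖N t x‖ ≤ C' / (1 + ‖x‖ + Real.sqrt (-t)) := h t ht x
      _ ≤ C' / 1 := div_le_div_of_nonneg_left hC' one_pos hden
      _ = C' := div_one _
  · have hst : 0 < Real.sqrt (-t) := Real.sqrt_pos.2 (by linarith)
    have hden : Real.sqrt (-t) ≤ 1 + ‖x‖ + Real.sqrt (-t) := by
      have := norm_nonneg x; linarith
    exact (h t ht x).trans (div_le_div_of_nonneg_left hC' hst hden)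
  · have hden : 0 < 1 + ‖y‖ + Real.sqrt (-s) := by positivity
    have h1 := h s hs y
    rw [le_div_iff₀ hden] at h1
    nlinarith [norm_nonneg (N s y), norm_nonneg y, Real.sqrt_nonneg (-s)]

end Summit.NavierStokesRegularity.NavierStokesRegularity.Cruxes.ApexLocalisation.DrefuteG2
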